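import Summits.ResolutionOfSingularities.ResolutionOfSingularities.Theorems.WildQuotientsSummitReductionStubPairOrbitBlowupCentreLocalLemmas18
import Summits.ResolutionOfSingularities.ResolutionOfSingularities.Theorems.WildQuotientsSummitReductionStubPairOrbitBlowupCentreLocalLemmas7
import Literature.AlgebraicGeometry.Resolution.AlterationsFibrationReductionZariski
import Mathlib.AlgebraicGeometry.Noetherian
import HarnessLib

/-!
# `WildQuotients.SummitReduction` (stmt-ResolutionOfSingularities-16324), line `FramePerfect`:
# the closed points of the geometric fibres of the blown-up curve over the non-origins of the charts
# are nonsingular points of curves (stub `stub_pair_orbitBlowupCentreLocal`, file 19: clause (H2) off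
# the origins, scheme level)

Route `ResolutionOfSingularities/WildQuotients`, crux `SummitReduction`; helper file of stub
`stub_pair_orbitBlowupCentreLocal` (C2: de Jong 1996, 3.4 Claim (ii) over the orbit centre). For a
morphism `g : X → Y` locally of finite type (`X` locally Noetherian), a geometric point
`s̄ : Spec K → Y` and a CLOSED point `x̄'` of `X ×_Y Spec K` over a point `x'` of `X` at which
`𝒪̂_{X,x'} ≅ T̂` compatibly with the base through Cohen coordinates, `T` a local ring of a chart
`Λ[x, y]/(xy - a₀)` at a prime `𝔔 ⊇ 𝔪_Λ` with `𝔔 ∌ x̄` or `𝔔 ∌ ȳ` (the output of file 6 at a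
point over the centre which is not an origin of its chart), **the local ring
`𝒪_{X ×_Y Spec K, x̄'}` is regular of dimension `1`**
(`isRegularLocalRing_and_ringKrullDim_pullback_of_chart_of_not_origin`; "This scheme is smooth over
`k`, except at the maximal ideal `(u, t₁')`", de Jong 1996, p. 64, at the `K`-points). This is the
algebra of file 18 at the stalks along an affine chart of the fibre product (stub QS,
`exists_affineChart_pullback`), the rationality of `x̄'` being that of a closed point of a scheme
locally of finite type over the algebraically closed `K` (Hilbert's Nullstellensatz,
`surjective_residueFieldMap_of_isClosed`), and `𝔪_{Spec K} = 0`.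
-/

set_option linter.dupNamespace false

noncomputable section

open CategoryTheory CategoryTheory.Limits AlgebraicGeometry TopologicalSpace TensorProduct IsLocalRing
open Literature.AlgebraicGeometry.Resolution
open Literature.AlgebraicGeometry.Resolution.DeJong1996

namespace Summit.ResolutionOfSingularities.ResolutionOfSingularities.Theorems

set_option maxHeartbeats 1600000 in
/-- **Closed points of the geometric fibres over the non-origins of the charts are nonsingular
points of curves** (de Jong 1996, 3.4 Claim (ii), p. 64, at the `K`-points of the special fibres
`k[u, t₁']/(ut₁')`, `k[u', v']/(u'v' - c̄)` of the charts away from the origin). Let `g : X → Y` be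
locally of finite type, `X` locally Noetherian, `s̄ : Spec K → Y` with `K` algebraically closed,
and `x̄'` a closed point of `X ×_Y Spec K`; if at `x' = pr₁ x̄'` one has `𝒪̂_{X,x'} ≅ T̂`
compatibly with `𝒪_{Y,g x'} → Λ → T` (`β : 𝒪_{Y,g x'} → Λ` residually onto with
`𝔪_{g x'} Λ = 𝔪_Λ`, `T` a local ring of `Λ[x, y]/(xy - a₀)` at a prime `𝔔 ⊇ 𝔪_Λ` not containing
both `x̄` and `ȳ`), then `𝒪_{X ×_Y Spec K, x̄'}` is a regular local ring of dimension `1`.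
[cite: DeJong1996, 3.4 Claim (ii), pp. 63–64] -/
theorem isRegularLocalRing_and_ringKrullDim_pullback_of_chart_of_not_origin {X Y : Scheme.{0}}
    [IsLocallyNoetherian X] (g : X ⟶ Y) [LocallyOfFiniteType g] (K : Type) [Field K]
    [IsAlgClosed K] (s : Spec (.of K) ⟶ Y) (xbar : ↥(pullback g s))
    (hcl : IsClosed ({xbar} : Set ↥(pullback g s)))
    {Λ : Type} [CommRing Λ] [IsLocalRing Λ]
    (β : Y.presheaf.stalk (g (pullback.fst g s xbar)) →+* Λ)
    (hβM : (maximalIdeal (Y.presheaf.stalk (g (pullback.fst g s xbar)))).map β = maximalIdeal Λ)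
    (hβR : Function.Surjective ((Ideal.Quotient.mk (maximalIdeal Λ)).comp β))
    {a₀ : Λ} (𝔔 : Ideal (AlgebraicNodeRing Λ a₀)) [𝔔.IsPrime] (T : Type) [CommRing T]
    [IsLocalRing T] [IsNoetherianRing T] [Algebra (AlgebraicNodeRing Λ a₀) T]
    [IsLocalization.AtPrime T 𝔔] [Algebra Λ T] [IsScalarTower Λ (AlgebraicNodeRing Λ a₀) T]
    (h𝔔Λ : (maximalIdeal Λ).map (algebraMap Λ (AlgebraicNodeRing Λ a₀)) ≤ 𝔔)
    (E : LocalCpl (X.presheaf.stalk (pullback.fst g s xbar)) ≃+* LocalCpl T)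
    (hE : ∀ a, E (AdicCompletion.of _ _ ((g.stalkMap (pullback.fst g s xbar)).hom a)) =
      AdicCompletion.of _ _ (algebraMap Λ T (β a)))
    (hoff : ¬ (AlgebraicNodeRing.u Λ a₀ ∈ 𝔔 ∧ AlgebraicNodeRing.v Λ a₀ ∈ 𝔔)) :
    IsRegularLocalRing ((pullback g s).presheaf.stalk xbar) ∧
      ringKrullDim ((pullback g s).presheaf.stalk xbar) = 1 := by
  classical
  haveI : IsLocallyNoetherian (pullback g s) := LocallyOfFiniteType.isLocallyNoetherian (pullback.snd g s)
  -- affine charts: `V ∋ g x'` in `Y`, `U ∋ x'` in `X` over `V`, and `⊤` of `Spec K`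
  obtain ⟨_, ⟨V, hV, rfl⟩, hyV, -⟩ := Y.isBasis_affineOpens.exists_subset_of_mem_open
    (Set.mem_univ (g (pullback.fst g s xbar))) isOpen_univ
  obtain ⟨_, ⟨U, hU, rfl⟩, hxU, hUV⟩ := X.isBasis_affineOpens.exists_subset_of_mem_open
    (show pullback.fst g s xbar ∈ g ⁻¹ᵁ V from hyV) (g ⁻¹ᵁ V).isOpen
  have hsV : s (pullback.snd g s xbar) ∈ V := by
    rw [← Scheme.Hom.comp_apply, ← pullback.condition, Scheme.Hom.comp_apply]
    exact hyV
  have hV'V : (⊤ : (Spec (.of K)).Opens) ≤ s ⁻¹ᵁ V := by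
    rw [Scheme.preimage_eq_top_of_closedPoint_mem s (by
      rwa [show closedPoint K = pullback.snd g s xbar from Subsingleton.elim _ _])]
  letI : Algebra Γ(Y, V) Γ(X, U) := (g.appLE V U hUV).hom.toAlgebra
  letI : Algebra Γ(Y, V) Γ(Spec (.of K), ⊤) := (s.appLE V ⊤ hV'V).hom.toAlgebra
  obtain ⟨χ, t, hχ, ht, hS1, hS2⟩ := exists_affineChart_pullback g s hV hU hUV (isAffineOpen_top _) hV'V
    rfl rfl xbar hxU (by trivial)
  haveI := hχ
  subst ht
  -- rationality of the closed point `χ t` over the algebraically closed `K`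
  have hsurjRF : Function.Surjective ((pullback.snd g s).residueFieldMap (χ t)) :=
    surjective_residueFieldMap_of_isClosed (pullback.snd g s) (pullback.snd g s) (𝟙 _)
      (Category.comp_id _) (χ t) hcl (by
        rw [show ({pullback.snd g s (χ t)} : Set ↥(Spec (.of K))) = Set.univ from
          Set.eq_univ_of_forall fun z => Subsingleton.elim _ _]
        exact isClosed_univ)
  have hrat : Function.Surjective ((IsLocalRing.residue ((pullback g s).presheaf.stalk (χ t))).comp
      ((pullback.snd g s).stalkMap (χ t)).hom) := by
    intro z
    obtain ⟨w, rfl⟩ := hsurjRF z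
    obtain ⟨r, rfl⟩ := IsLocalRing.residue_surjective w
    refine ⟨r, ?_⟩
    have h := CommRingCat.hom_ext_iff.mp (Scheme.residue_residueFieldMap (pullback.snd g s) (χ t))
    have h' := RingHom.congr_fun h r
    simp only [CommRingCat.hom_comp, RingHom.comp_apply] at h'
    exact h'.symm
  -- the local rings and the maps between them (as in the transfer of stub QS)
  have hxU' : pullback.fst g s (χ t) ∈ U := apply_apply_mem_of_comp_eq χ (pullback.fst g s) hU _ hS1 t
  have hy'V' : pullback.snd g s (χ t) ∈ (⊤ : (Spec (.of K)).Opens) := trivial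
  have hyy : g (pullback.fst g s (χ t)) = s (pullback.snd g s (χ t)) := by
    rw [← Scheme.Hom.comp_apply, pullback.condition, Scheme.Hom.comp_apply]
  let φ : (Y.presheaf.stalk (g (pullback.fst g s (χ t))) : Type) →+* X.presheaf.stalk (pullback.fst g s (χ t)) :=
    (g.stalkMap (pullback.fst g s (χ t))).hom
  let π : (X.presheaf.stalk (pullback.fst g s (χ t)) : Type) →+* (pullback g s).presheaf.stalk (χ t) :=
    ((pullback.fst g s).stalkMap (χ t)).hom
  let φ' : ((Spec (.of K)).presheaf.stalk (pullback.snd g s (χ t)) : Type) →+*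
      (pullback g s).presheaf.stalk (χ t) := ((pullback.snd g s).stalkMap (χ t)).hom
  let ρ : (Y.presheaf.stalk (g (pullback.fst g s (χ t))) : Type) →+*
      (Spec (.of K)).presheaf.stalk (pullback.snd g s (χ t)) :=
    (s.stalkMap (pullback.snd g s (χ t))).hom.comp (Y.presheaf.stalkCongr (.of_eq hyy)).hom.hom
  have hsq : ∀ r, φ' (ρ r) = π (φ r) := by
    intro r
    have h := Scheme.Hom.stalkMap_congr_hom _ _ (pullback.condition (f := g) (g := s)) (χ t)
    rw [Scheme.Hom.stalkMap_comp, Scheme.Hom.stalkMap_comp] at h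
    have h' := congrArg (fun q => q.hom r) h
    simp only [CommRingCat.hom_comp, RingHom.coe_comp, Function.comp_apply] at h'
    exact h'.symm
  let S : Type := Γ(X, U) ⊗[Γ(Y, V)] Γ(Spec (.of K), ⊤)
  let γA : (Γ(Y, V) : Type) →+* Y.presheaf.stalk (g (pullback.fst g s (χ t))) := (Y.presheaf.germ V _ hyV).hom
  let γC : (Γ(X, U) : Type) →+* X.presheaf.stalk (pullback.fst g s (χ t)) := (X.presheaf.germ U _ hxU').hom
  let γA' : (Γ(Spec (.of K), ⊤) : Type) →+* (Spec (.of K)).presheaf.stalk (pullback.snd g s (χ t)) :=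
    ((Spec (.of K)).presheaf.germ ⊤ _ hy'V').hom
  let σ : S →+* (pullback g s).presheaf.stalk (χ t) := (inv (χ.stalkMap t)).hom.comp
    ((Scheme.ΓSpecIso (.of S)).inv ≫ (Spec (.of S)).presheaf.germ ⊤ t trivial).hom
  have h0a : ∀ a, γC (algebraMap Γ(Y, V) Γ(X, U) a) = φ (γA a) := fun a => germ_appLE_apply g hUV hxU' a
  have h0b : ∀ a, γA' (algebraMap Γ(Y, V) Γ(Spec (.of K), ⊤) a) = ρ (γA a) := fun a => by
    change _ = (s.stalkMap (pullback.snd g s (χ t))).hom ((Y.presheaf.stalkCongr (.of_eq hyy)).hom.hom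
        ((Y.presheaf.germ V _ hyV).hom a))
    rw [stalkCongr_germ_apply hyy hyV a]
    exact germ_appLE_apply s hV'V hy'V' a
  have h1 : ∀ c, σ (c ⊗ₜ 1) = π (γC c) := fun c => by
    have h := congrArg (inv (χ.stalkMap t)).hom
      (stalkMap_stalkMap_germ_eq_germ_of_comp_eq χ (pullback.fst g s) hU _ hS1 t hxU' c)
    rw [inv_stalkMap_apply] at h
    exact h.symm
  have h2 : ∀ a', σ (1 ⊗ₜ a') = φ' (γA' a') := fun a' => by
    have h := congrArg (inv (χ.stalkMap t)).hom
      (stalkMap_stalkMap_germ_eq_germ_of_comp_eq χ (pullback.snd g s) (isAffineOpen_top _) _ hS2 t hy'V' a')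
    rw [inv_stalkMap_apply] at h
    exact h.symm
  have hO : ∀ o : X.presheaf.stalk (pullback.fst g s (χ t)), ∃ c₁ c₂ : Γ(X, U),
      IsUnit (γC c₂) ∧ o * γC c₂ = γC c₁ := exists_germ_mul_eq_germ hU hxU'
  have hR' : ∀ r : (Spec (.of K)).presheaf.stalk (pullback.snd g s (χ t)), ∃ a₁ a₂ : Γ(Spec (.of K), ⊤),
      IsUnit (γA' a₂) ∧ r * γA' a₂ = γA' a₁ := exists_germ_mul_eq_germ (isAffineOpen_top _) hy'V'
  have hR'' : maximalIdeal ((Spec (.of K)).presheaf.stalk (pullback.snd g s (χ t))) ≤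
      ((maximalIdeal ((Spec (.of K)).presheaf.stalk (pullback.snd g s (χ t)))).comap γA').map γA' :=
    maximalIdeal_le_map_comap_germ (isAffineOpen_top _) hy'V'
  have hO'₁ : ∀ o : (pullback g s).presheaf.stalk (χ t), ∃ s' u, IsUnit (σ u) ∧ o * σ u = σ s' :=
    exists_mul_eq_of_isIso_stalkMap χ t
  have hO'₂ : ∀ (I : Ideal S) (s'), σ s' ∈ I.map σ → ∃ u, IsUnit (σ u) ∧ u * s' ∈ I :=
    exists_isUnit_mul_mem_of_isIso_stalkMap χ t
  haveI hφloc : IsLocalHom φ := inferInstanceAs (IsLocalHom (g.stalkMap (pullback.fst g s (χ t))).hom)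
  haveI hφ'loc : IsLocalHom φ' := inferInstanceAs (IsLocalHom ((pullback.snd g s).stalkMap (χ t)).hom)
  haveI hπloc : IsLocalHom π := inferInstanceAs (IsLocalHom ((pullback.fst g s).stalkMap (χ t)).hom)
  haveI : IsLocalHom (Y.presheaf.stalkCongr (X := Y) (Inseparable.of_eq hyy)).hom.hom := isLocalHom_of_isIso _
  haveI hρloc : IsLocalHom ρ := RingHom.isLocalHom_comp _ _
  -- the algebra (file 18)
  obtain ⟨hreg, hdim⟩ := isRegularLocalRing_and_ringKrullDim_fibreRing_of_chart φ ρ φ' π γA γC γA' σ hsq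
    h0a h0b h1 h2 hO hR' hR'' hO'₁ hO'₂ β hβM hβR 𝔔 T h𝔔Λ E hE hoff hrat
  -- `𝔪_{Spec K} = 0`, so the fibre local ring is the whole local ring
  have hm : maximalIdeal ((Spec (.of K)).presheaf.stalk (pullback.snd g s (χ t))) = ⊥ :=
    isField_iff_maximalIdeal_eq.mp (isField_stalk_spec_field K _)
  have hJ : (maximalIdeal ((Spec (.of K)).presheaf.stalk (pullback.snd g s (χ t)))).map φ' = ⊥ := by
    rw [hm, Ideal.map_bot]
  let e := (Ideal.quotEquivOfEq hJ).trans (RingEquiv.quotientBot ((pullback g s).presheaf.stalk (χ t)))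
  haveI := hreg
  exact ⟨IsRegularLocalRing.of_ringEquiv (R := (pullback g s).presheaf.stalk (χ t) ⧸
      (maximalIdeal ((Spec (.of K)).presheaf.stalk (pullback.snd g s (χ t)))).map φ')
    (R' := (pullback g s).presheaf.stalk (χ t)) e,
    by rw [← ringKrullDim_eq_of_ringEquiv e]; exact hdim⟩

end Summit.ResolutionOfSingularities.ResolutionOfSingularities.Theorems

end
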